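import Mathlib
import HarnessLib
import Summits.Ventures.LatticeQCDFlow.Exactness.NCMCGeneralSpaceTwoSampleBlocksFreeEnergyCLT
import Summits.Ventures.LatticeQCDFlow.Exactness.NCMCGeneralSpaceStudentizedCLT

/-!
# Unequal sample sizes, III: the two Kish fractions of `a·n` forward and `b·n` reverse evolutions studentize the estimate

HONEST FRAMING: exact (Metropolis-corrected) sampling algorithms for lattice gauge theory;
figures of merit are autocorrelation/cost numbers at stated couplings and volumes; no
continuum-physics claim.

Venture `LatticeQCDFlow` (cell pub-lqcd), topic `Exactness`; FANOUT row 13 (`eng-snf`, GEN-14).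
NEW WORK of the cell (elementary asymptotic statistics: the strong law over blocks, Slutsky's theorem,
one implication of the portmanteau theorem), not a published result; nothing is cited as a fact.
Continuation of `NCMCGeneralSpaceTwoSampleBlocksFreeEnergyCLT.lean` (GEN-14:
`√n (ΔF̂_n − ΔF) →d N(0, V_{a,b}(α))`, `V_{a,b}(α) = v_F/a + v_R/b`, for the two-sample estimate from
`a·n` forward and `b·n` reverse independent evolutions) and of `NCMCGeneralSpaceTwoSampleStudentizedCLT.lean`
(GEN-14, `a = b = 1`).  Here the PLUG-IN: `v_F = E_F[(αe^{−W})²]/E_F[αe^{−W}]² − 1` is estimated by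
`1/essHat_F − 1` of ALL `a·n` forward weights, `v_R` by `1/essHat_R − 1` of all `b·n` reverse weights.

## Setting and content

Block runs `ω : ℕ → (Fin a → E) × (Fin b → E)` under `Measure.infinitePi (fun _ => P_F^{⊗a} ⊗ P_R^{⊗b})`;
forward weights `w_{k,l} = α(ε_{k,l}) e^{−W(ε_{k,l})}` (`k < n`, `l < a`), reverse weights
`u_{k,l} = α(ε'_{k,l})` (`l < b`); the variance-inflation plug-ins written with block sums,
`T^F_n = (a n) Σ_{k,l} w_{k,l}² / (Σ_{k,l} w_{k,l})² − 1` and `T^R_n` likewise — these ARE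
`1/essHat − 1` of the flattened families (`one_div_essHat_prod_sub_one`).

* `one_div_essHat_prod_sub_one` — `1/essHat(w over Fin n × Fin m) − 1 = (n m) ΣΣ w²/(ΣΣ w)² − 1`.
* `tendsto_blocks_invEss_sub_one_ae` — generic: for block statistics `S₁ > 0`, `S₂` with means
  `m θ`, `m m₂` on a block law `μB`, `(m n) Σ_{k<n} S₂(ω k)/(Σ_{k<n} S₁(ω k))² − 1 → m₂/θ² − 1` a.s.
  along `Measure.infinitePi (fun _ => μB)` (two strong laws).
* **`CrooksPair.tendsto_twoSample_blocks_pluginVariance_ae`** — `T^F_n/a + T^R_n/b → V_{a,b}(α)` a.s.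
* **`CrooksPair.tendstoInDistribution_twoSample_blocks_studentized`** —
  `√n (ΔF̂_n − ΔF)/√(T^F_n/a + T^R_n/b) →d N(0, 1)` (`V_{a,b}(α) > 0`);
  **`CrooksPair.tendsto_measure_abs_twoSample_blocks_sub_le`** — COVERAGE → `gaussianReal 0 1 [−z, z]`.
  Reading for the engine (`estimators.bar` / `twosided` with `nf = a·n ≠ nr = b·n`): the honest error
  bar is `√((1/essHat_F − 1)/nf + (1/essHat_R − 1)/nr)` with the Kish fractions of ALL forward and
  ALL reverse weights — since `(T^F/a + T^R/b)/n = T^F/nf + T^R/nr`.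

Scope / NOT CLAIMED: fixed ratio `a : b`; independent evolutions; fixed statistic `α`; asymptotic
coverage only, no rate; `V_{a,b}(α) = 0` excluded; no value for any concrete protocol.
-/

namespace Summit.Ventures.LatticeQCDFlow.Exactness.GeneralNCMC

open MeasureTheory ProbabilityTheory Set Filter Finset
open scoped ENNReal NNReal Topology

variable {E : Type*} [MeasurableSpace E]

/-! ## The plug-in is `1/essHat − 1` of the flattened family -/

/-- For a doubly indexed family, `1/essHat − 1` over `Fin n × Fin m` is
`(n m) Σ_k Σ_l w_{k,l}² / (Σ_k Σ_l w_{k,l})² − 1`. -/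
theorem one_div_essHat_prod_sub_one {n m : ℕ} (w : Fin n → Fin m → ℝ) :
    1 / essHat (fun kl : Fin n × Fin m => w kl.1 kl.2) - 1 =
      ((n : ℝ) * m) * (∑ k, ∑ l, w k l ^ 2) / (∑ k, ∑ l, w k l) ^ 2 - 1 := by
  unfold essHat
  rw [Fintype.card_prod, Fintype.card_fin, Fintype.card_fin, Fintype.sum_prod_type,
    Fintype.sum_prod_type, one_div_div, Nat.cast_mul, mul_div_assoc]

/-! ## The strong law for the block plug-in -/

/-- **Strong consistency of a block variance-inflation plug-in.**  On a block law `μB`, for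
measurable integrable block statistics `S₁ > 0` and `S₂` with means `m θ` and `m m₂` (`m, θ ≠ 0`),
along the i.i.d. block run: `(m n) Σ_{k<n} S₂(ω k) / (Σ_{k<n} S₁(ω k))² − 1 → m₂/θ² − 1` almost surely. -/
theorem tendsto_blocks_invEss_sub_one_ae {B : Type*} [MeasurableSpace B] (μB : Measure B)
    [IsProbabilityMeasure μB] {S₁ S₂ : B → ℝ} (hS1m : Measurable S₁) (hS2m : Measurable S₂)
    (hS1i : Integrable S₁ μB) (hS2i : Integrable S₂ μB) (hS1pos : ∀ x, 0 < S₁ x) {m θ m₂ : ℝ}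
    (hm : m ≠ 0) (hθ : θ ≠ 0) (hI1 : ∫ x, S₁ x ∂μB = m * θ) (hI2 : ∫ x, S₂ x ∂μB = m * m₂) :
    ∀ᵐ ω ∂(Measure.infinitePi fun _ : ℕ => μB),
      Tendsto (fun n : ℕ => (m * n) * (∑ k ∈ range n, S₂ (ω k)) / (∑ k ∈ range n, S₁ (ω k)) ^ 2 - 1)
        atTop (𝓝 (m₂ / θ ^ 2 - 1)) := by
  filter_upwards [tendsto_sampleMean_ae μB hS1m hS1i, tendsto_sampleMean_ae μB hS2m hS2i] with ω hω1 hω2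
  rw [hI1] at hω1
  rw [hI2] at hω2
  have hlim : Tendsto (fun n : ℕ => m * sampleMean S₂ (fun i : Fin n => ω i) /
      (sampleMean S₁ (fun i : Fin n => ω i)) ^ 2 - 1) atTop (𝓝 (m₂ / θ ^ 2 - 1)) := by
    have key := ((hω2.const_mul m).div (hω1.pow 2) (pow_ne_zero 2 (mul_ne_zero hm hθ))).sub_const 1
    have hval : m * (m * m₂) / (m * θ) ^ 2 - 1 = m₂ / θ ^ 2 - 1 := by
      field_simp
    rw [hval] at key
    exact key
  refine hlim.congr' ?_
  filter_upwards [eventually_gt_atTop 0] with n hn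
  have hn' : (n : ℝ) ≠ 0 := by exact_mod_cast hn.ne'
  unfold sampleMean
  rw [Fin.sum_univ_eq_sum_range (fun k => S₂ (ω k)) n, Fin.sum_univ_eq_sum_range (fun k => S₁ (ω k)) n]
  have hS : (∑ k ∈ range n, S₁ (ω k)) ≠ 0 :=
    (sum_pos (fun k _ => hS1pos (ω k)) (nonempty_range_iff.2 hn.ne')).ne'
  field_simp

/-! ## For a Crooks pair: the studentized two-sample estimate with `nf = a·n`, `nr = b·n` -/

namespace CrooksPair

variable {Ω : Type*} [MeasurableSpace Ω]
variable {ν₀ ν₁ : Measure Ω} {κF κR : Kernel Ω E} {s e : E → Ω} {W : E → ℝ}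
variable {Ω' : Type*} [MeasurableSpace Ω'] {P' : Measure Ω'} [IsProbabilityMeasure P']

/-- **The block plug-in of Bennett's functional is strongly consistent**:
`T^F_n/a + T^R_n/b → V_{a,b}(α)` almost surely along the block run. -/
theorem tendsto_twoSample_blocks_pluginVariance_ae [IsFiniteMeasure ν₀] [IsFiniteMeasure ν₁]
    [IsMarkovKernel κF] [IsMarkovKernel κR] (h0 : ν₀ univ ≠ 0) (h1 : ν₁ univ ≠ 0)
    (h : CrooksPair ν₀ ν₁ κF κR s e W) {α : E → ℝ} (hαm : Measurable α) (hαpos : ∀ ε, 0 < α ε)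
    (hA2 : MemLp (fun ε => α ε * Real.exp (-W ε)) 2 (fwdPathLaw ν₀ κF))
    (hB2 : MemLp α 2 (fwdPathLaw ν₁ κR)) {a b : ℕ} (ha : 0 < a) (hb : 0 < b) :
    haveI := isProbabilityMeasure_fwdPathLaw ν₀ h0 κF
    haveI := isProbabilityMeasure_fwdPathLaw ν₁ h1 κR
    ∀ᵐ ω ∂(Measure.infinitePi fun _ : ℕ =>
        (Measure.pi fun _ : Fin a => fwdPathLaw ν₀ κF).prod (Measure.pi fun _ : Fin b => fwdPathLaw ν₁ κR)),
      Tendsto (fun n : ℕ =>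
        (((a : ℝ) * n) * (∑ k ∈ range n, ∑ l, (α ((ω k).1 l) * Real.exp (-W ((ω k).1 l))) ^ 2) /
            (∑ k ∈ range n, ∑ l, α ((ω k).1 l) * Real.exp (-W ((ω k).1 l))) ^ 2 - 1) / a +
          (((b : ℝ) * n) * (∑ k ∈ range n, ∑ l, α ((ω k).2 l) ^ 2) /
            (∑ k ∈ range n, ∑ l, α ((ω k).2 l)) ^ 2 - 1) / b) atTop
        (𝓝 (((∫ ε, (α ε * Real.exp (-W ε)) ^ 2 ∂(fwdPathLaw ν₀ κF)) /
            (∫ ε, α ε * Real.exp (-W ε) ∂(fwdPathLaw ν₀ κF)) ^ 2 - 1) / a +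
          ((∫ ε, α ε ^ 2 ∂(fwdPathLaw ν₁ κR)) / (∫ ε, α ε ∂(fwdPathLaw ν₁ κR)) ^ 2 - 1) / b)) := by
  haveI := isProbabilityMeasure_fwdPathLaw ν₀ h0 κF
  haveI := isProbabilityMeasure_fwdPathLaw ν₁ h1 κR
  set PF := fwdPathLaw ν₀ κF with hPF
  set PR := fwdPathLaw ν₁ κR with hPR
  set μF := Measure.pi fun _ : Fin a => PF with hμF
  set μR := Measure.pi fun _ : Fin b => PR with hμR
  set μ := μF.prod μR with hμ
  haveI : Nonempty (Fin a) := Fin.pos_iff_nonempty.1 ha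
  haveI : Nonempty (Fin b) := Fin.pos_iff_nonempty.1 hb
  have hfst := measurePreserving_fst (μ := μF) (ν := μR)
  have hsnd := measurePreserving_snd (μ := μF) (ν := μR)
  have hgm : Measurable fun ε => α ε * Real.exp (-W ε) :=
    hαm.mul (Real.measurable_exp.comp h.measurable_W.neg)
  -- forward leg: block sums of `w = α e^{−W}` and `w²` as functions of the first component
  have hF1m : Measurable fun p : (Fin a → E) × (Fin b → E) => ∑ l, α (p.1 l) * Real.exp (-W (p.1 l)) :=
    (measurable_blockSum hgm).comp measurable_fst
  have hF2m : Measurable fun p : (Fin a → E) × (Fin b → E) =>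
      ∑ l, (α (p.1 l) * Real.exp (-W (p.1 l))) ^ 2 :=
    (measurable_blockSum (hgm.pow_const 2)).comp measurable_fst
  have hF1blk : Integrable (fun x : Fin a → E => ∑ l, α (x l) * Real.exp (-W (x l))) μF :=
    (memLp_blockSum PF hA2).integrable one_le_two
  have hF2blk : Integrable (fun x : Fin a → E => ∑ l, (α (x l) * Real.exp (-W (x l))) ^ 2) μF :=
    integrable_finsetSum _ fun l _ =>
      (measurePreserving_eval (fun _ : Fin a => PF) l).integrable_comp_of_integrable hA2.integrable_sq
  have hF1i : Integrable (fun p : (Fin a → E) × (Fin b → E) => ∑ l, α (p.1 l) * Real.exp (-W (p.1 l))) μ :=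
    hfst.integrable_comp_of_integrable hF1blk
  have hF2i : Integrable (fun p : (Fin a → E) × (Fin b → E) =>
      ∑ l, (α (p.1 l) * Real.exp (-W (p.1 l))) ^ 2) μ := hfst.integrable_comp_of_integrable hF2blk
  have hIF1 : ∫ p, ∑ l, α (p.1 l) * Real.exp (-W (p.1 l)) ∂μ = a * ∫ ε, α ε * Real.exp (-W ε) ∂PF := by
    rw [integral_comp_of_measurePreserving hfst hF1blk.aestronglyMeasurable]
    exact integral_blockSum PF (hA2.integrable one_le_two)
  have hIF2 : ∫ p, ∑ l, (α (p.1 l) * Real.exp (-W (p.1 l))) ^ 2 ∂μ =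
      a * ∫ ε, (α ε * Real.exp (-W ε)) ^ 2 ∂PF := by
    rw [integral_comp_of_measurePreserving hfst hF2blk.aestronglyMeasurable]
    exact integral_blockSum PF (g := fun ε => (α ε * Real.exp (-W ε)) ^ 2) hA2.integrable_sq
  -- reverse leg
  have hR1m : Measurable fun p : (Fin a → E) × (Fin b → E) => ∑ l, α (p.2 l) :=
    (measurable_blockSum hαm).comp measurable_snd
  have hR2m : Measurable fun p : (Fin a → E) × (Fin b → E) => ∑ l, α (p.2 l) ^ 2 :=
    (measurable_blockSum (hαm.pow_const 2)).comp measurable_snd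
  have hR1blk : Integrable (fun y : Fin b → E => ∑ l, α (y l)) μR :=
    (memLp_blockSum PR hB2).integrable one_le_two
  have hR2blk : Integrable (fun y : Fin b → E => ∑ l, α (y l) ^ 2) μR :=
    integrable_finsetSum _ fun l _ =>
      (measurePreserving_eval (fun _ : Fin b => PR) l).integrable_comp_of_integrable hB2.integrable_sq
  have hR1i : Integrable (fun p : (Fin a → E) × (Fin b → E) => ∑ l, α (p.2 l)) μ :=
    hsnd.integrable_comp_of_integrable hR1blk
  have hR2i : Integrable (fun p : (Fin a → E) × (Fin b → E) => ∑ l, α (p.2 l) ^ 2) μ :=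
    hsnd.integrable_comp_of_integrable hR2blk
  have hIR1 : ∫ p, ∑ l, α (p.2 l) ∂μ = b * ∫ ε, α ε ∂PR := by
    rw [integral_comp_of_measurePreserving hsnd hR1blk.aestronglyMeasurable]
    exact integral_blockSum PR (hB2.integrable one_le_two)
  have hIR2 : ∫ p, ∑ l, α (p.2 l) ^ 2 ∂μ = b * ∫ ε, α ε ^ 2 ∂PR := by
    rw [integral_comp_of_measurePreserving hsnd hR2blk.aestronglyMeasurable]
    exact integral_blockSum PR (g := fun ε => α ε ^ 2) hB2.integrable_sq
  -- positivity of the two means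
  have hmB : ∫ ε, α ε ∂PR ≠ 0 := by
    have hpos : 0 < ∫ ε, α ε ∂PR := by
      rw [integral_pos_iff_support_of_nonneg (fun ε => (hαpos ε).le) (hB2.integrable one_le_two)]
      have hsupp : Function.support α = univ := by
        ext ε
        simp only [Function.mem_support, mem_univ, iff_true]
        exact (hαpos ε).ne'
      rw [hsupp, measure_univ]
      exact one_pos
    exact hpos.ne'
  have hmA : ∫ ε, α ε * Real.exp (-W ε) ∂PF ≠ 0 := by
    have hpos : 0 < ∫ ε, α ε * Real.exp (-W ε) ∂PF := by
      rw [integral_pos_iff_support_of_nonneg (fun ε => (mul_pos (hαpos ε) (Real.exp_pos _)).le)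
        (hA2.integrable one_le_two)]
      have hsupp : Function.support (fun ε => α ε * Real.exp (-W ε)) = univ := by
        ext ε
        simp only [Function.mem_support, mem_univ, iff_true]
        exact (mul_pos (hαpos ε) (Real.exp_pos _)).ne'
      rw [hsupp, measure_univ]
      exact one_pos
    exact hpos.ne'
  have ha' : (a : ℝ) ≠ 0 := by exact_mod_cast ha.ne'
  have hb' : (b : ℝ) ≠ 0 := by exact_mod_cast hb.ne'
  have hTF := tendsto_blocks_invEss_sub_one_ae μ hF1m hF2m hF1i hF2i
    (fun p => sum_pos (fun l _ => mul_pos (hαpos (p.1 l)) (Real.exp_pos _)) univ_nonempty)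
    ha' hmA hIF1 hIF2
  have hTR := tendsto_blocks_invEss_sub_one_ae μ hR1m hR2m hR1i hR2i
    (fun p => sum_pos (fun l _ => hαpos (p.2 l)) univ_nonempty) hb' hmB hIR1 hIR2
  filter_upwards [hTF, hTR] with ω hωF hωR
  exact (hωF.div_const (a : ℝ)).add (hωR.div_const (b : ℝ))

/-- **Studentized two-sample CLT with sample-size ratio `a : b`.**  For every Crooks pair with
`e^{−ΔF} = Z₁/Z₀`, every positive measurable statistic `α` with `α e^{−W} ∈ L²(P_F)`,
`α ∈ L²(P_R)`, block sizes `a, b ≥ 1` and `V_{a,b}(α) > 0`, along the run of independent blocks: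
`√n (ΔF̂_n − ΔF)/√(T^F_n/a + T^R_n/b) →d N(0, 1)`, `T^F_n = 1/essHat_F − 1` of all `a·n` forward
weights, `T^R_n = 1/essHat_R − 1` of all `b·n` reverse weights. -/
theorem tendstoInDistribution_twoSample_blocks_studentized [IsFiniteMeasure ν₀] [IsFiniteMeasure ν₁]
    [IsMarkovKernel κF] [IsMarkovKernel κR] (h0 : ν₀ univ ≠ 0) (h1 : ν₁ univ ≠ 0)
    (h : CrooksPair ν₀ ν₁ κF κR s e W) {α : E → ℝ} (hαm : Measurable α) (hαpos : ∀ ε, 0 < α ε)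
    (hA2 : MemLp (fun ε => α ε * Real.exp (-W ε)) 2 (fwdPathLaw ν₀ κF))
    (hB2 : MemLp α 2 (fwdPathLaw ν₁ κR)) {ΔF : ℝ}
    (hΔF : Real.exp (-ΔF) = ((ν₀ univ)⁻¹ * ν₁ univ).toReal) {a b : ℕ} (ha : 0 < a) (hb : 0 < b)
    (hV : 0 < ((∫ ε, (α ε * Real.exp (-W ε)) ^ 2 ∂(fwdPathLaw ν₀ κF)) /
          (∫ ε, α ε * Real.exp (-W ε) ∂(fwdPathLaw ν₀ κF)) ^ 2 - 1) / a +
        ((∫ ε, α ε ^ 2 ∂(fwdPathLaw ν₁ κR)) / (∫ ε, α ε ∂(fwdPathLaw ν₁ κR)) ^ 2 - 1) / b)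
    {Z : Ω' → ℝ} (hZ : HasLaw Z (gaussianReal 0 1) P') :
    haveI := isProbabilityMeasure_fwdPathLaw ν₀ h0 κF
    haveI := isProbabilityMeasure_fwdPathLaw ν₁ h1 κR
    TendstoInDistribution
      (fun (n : ℕ) (ω : ℕ → (Fin a → E) × (Fin b → E)) => √(n : ℝ) *
          (-Real.log ((∑ k ∈ range n, ∑ l, α ((ω k).1 l) * Real.exp (-W ((ω k).1 l))) / (a * n) /
            ((∑ k ∈ range n, ∑ l, α ((ω k).2 l)) / (b * n))) - ΔF) /
        √((((a : ℝ) * n) * (∑ k ∈ range n, ∑ l, (α ((ω k).1 l) * Real.exp (-W ((ω k).1 l))) ^ 2) /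
              (∑ k ∈ range n, ∑ l, α ((ω k).1 l) * Real.exp (-W ((ω k).1 l))) ^ 2 - 1) / a +
          (((b : ℝ) * n) * (∑ k ∈ range n, ∑ l, α ((ω k).2 l) ^ 2) /
              (∑ k ∈ range n, ∑ l, α ((ω k).2 l)) ^ 2 - 1) / b))
      atTop Z (fun _ => Measure.infinitePi fun _ : ℕ =>
        (Measure.pi fun _ : Fin a => fwdPathLaw ν₀ κF).prod (Measure.pi fun _ : Fin b => fwdPathLaw ν₁ κR))
      P' := by
  haveI := isProbabilityMeasure_fwdPathLaw ν₀ h0 κF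
  haveI := isProbabilityMeasure_fwdPathLaw ν₁ h1 κR
  set μ := (Measure.pi fun _ : Fin a => fwdPathLaw ν₀ κF).prod
    (Measure.pi fun _ : Fin b => fwdPathLaw ν₁ κR) with hμ
  set P := Measure.infinitePi fun _ : ℕ => μ with hP
  set V := ((∫ ε, (α ε * Real.exp (-W ε)) ^ 2 ∂(fwdPathLaw ν₀ κF)) /
          (∫ ε, α ε * Real.exp (-W ε) ∂(fwdPathLaw ν₀ κF)) ^ 2 - 1) / a +
        ((∫ ε, α ε ^ 2 ∂(fwdPathLaw ν₁ κR)) / (∫ ε, α ε ∂(fwdPathLaw ν₁ κR)) ^ 2 - 1) / b with hVdef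
  have hsV : √V ≠ 0 := (Real.sqrt_pos.2 hV).ne'
  have hY : HasLaw (fun ω' => √V * Z ω') (gaussianReal 0 V.toNNReal) P' := by
    have hg := gaussianReal_const_mul hZ (√V)
    rw [mul_zero, mul_one] at hg
    convert hg using 3
    apply NNReal.eq
    rw [Real.coe_toNNReal _ hV.le, NNReal.coe_mk, Real.sq_sqrt hV.le]
  have clt := h.tendstoInDistribution_twoSample_freeEnergy_blocks h0 h1 hαm hαpos hA2 hB2 hΔF ha hb hY
  -- measurability of the studentizing factor
  have hgm : Measurable fun ε => α ε * Real.exp (-W ε) :=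
    hαm.mul (Real.measurable_exp.comp h.measurable_W.neg)
  have hS : ∀ (g : E → ℝ), Measurable g → ∀ n : ℕ, Measurable fun ω : ℕ → (Fin a → E) × (Fin b → E) =>
      ∑ k ∈ range n, ∑ l, g ((ω k).1 l) := fun g hg n =>
    Finset.measurable_sum _ fun k _ =>
      (measurable_blockSum hg).comp (measurable_fst.comp (measurable_pi_apply k))
  have hS' : ∀ (g : E → ℝ), Measurable g → ∀ n : ℕ, Measurable fun ω : ℕ → (Fin a → E) × (Fin b → E) =>
      ∑ k ∈ range n, ∑ l, g ((ω k).2 l) := fun g hg n =>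
    Finset.measurable_sum _ fun k _ =>
      (measurable_blockSum hg).comp (measurable_snd.comp (measurable_pi_apply k))
  have hUmeas : ∀ n : ℕ, AEMeasurable (fun ω : ℕ → (Fin a → E) × (Fin b → E) =>
      (√((((a : ℝ) * n) * (∑ k ∈ range n, ∑ l, (α ((ω k).1 l) * Real.exp (-W ((ω k).1 l))) ^ 2) /
            (∑ k ∈ range n, ∑ l, α ((ω k).1 l) * Real.exp (-W ((ω k).1 l))) ^ 2 - 1) / a +
        (((b : ℝ) * n) * (∑ k ∈ range n, ∑ l, α ((ω k).2 l) ^ 2) /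
            (∑ k ∈ range n, ∑ l, α ((ω k).2 l)) ^ 2 - 1) / b))⁻¹) P := by
    intro n
    have h1 := hS (fun ε => (α ε * Real.exp (-W ε)) ^ 2) (hgm.pow_const 2) n
    have h2 := hS (fun ε => α ε * Real.exp (-W ε)) hgm n
    have h3 := hS' (fun ε => α ε ^ 2) (hαm.pow_const 2) n
    have h4 := hS' α hαm n
    exact ((((((measurable_const.mul h1).div (h2.pow_const 2)).sub_const 1).div_const _).add
      ((((measurable_const.mul h3).div (h4.pow_const 2)).sub_const 1).div_const _)).sqrt.inv).aemeasurable
  have hU : TendstoInMeasure P (fun (n : ℕ) (ω : ℕ → (Fin a → E) × (Fin b → E)) =>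
      (√((((a : ℝ) * n) * (∑ k ∈ range n, ∑ l, (α ((ω k).1 l) * Real.exp (-W ((ω k).1 l))) ^ 2) /
            (∑ k ∈ range n, ∑ l, α ((ω k).1 l) * Real.exp (-W ((ω k).1 l))) ^ 2 - 1) / a +
        (((b : ℝ) * n) * (∑ k ∈ range n, ∑ l, α ((ω k).2 l) ^ 2) /
            (∑ k ∈ range n, ∑ l, α ((ω k).2 l)) ^ 2 - 1) / b))⁻¹) atTop (fun _ => (√V)⁻¹) := by
    refine tendstoInMeasure_of_tendsto_ae (fun n => (hUmeas n).aestronglyMeasurable) ?_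
    filter_upwards [h.tendsto_twoSample_blocks_pluginVariance_ae h0 h1 hαm hαpos hA2 hB2 ha hb] with ω hω
    exact (hω.sqrt).inv₀ hsV
  have slutsky := clt.continuous_comp_prodMk_of_tendstoInMeasure_const
    (g := fun p : ℝ × ℝ => p.1 * p.2) (by fun_prop) hU hUmeas
  refine slutsky.congr (fun n => Eventually.of_forall fun ω => ?_)
    (Eventually.of_forall fun ω' => ?_)
  · simp only [div_eq_mul_inv]
  · show √V * Z ω' * (√V)⁻¹ = Z ω'
    rw [mul_comm (√V) (Z ω'), mul_inv_cancel_right₀ hsV]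

/-- **The two-sample interval with unequal leg sizes is asymptotically honest**: for `z ≥ 0` the
probability that `|√n (ΔF̂_n − ΔF)|/√(T^F_n/a + T^R_n/b) ≤ z` — i.e. that `ΔF` lies in `ΔF̂_n ± z·err_n`
with `err_n = √(T^F_n/nf + T^R_n/nr)`, `nf = a n`, `nr = b n` — tends to `gaussianReal 0 1 [−z, z]`. -/
theorem tendsto_measure_abs_twoSample_blocks_sub_le [IsFiniteMeasure ν₀] [IsFiniteMeasure ν₁]
    [IsMarkovKernel κF] [IsMarkovKernel κR] (h0 : ν₀ univ ≠ 0) (h1 : ν₁ univ ≠ 0)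
    (h : CrooksPair ν₀ ν₁ κF κR s e W) {α : E → ℝ} (hαm : Measurable α) (hαpos : ∀ ε, 0 < α ε)
    (hA2 : MemLp (fun ε => α ε * Real.exp (-W ε)) 2 (fwdPathLaw ν₀ κF))
    (hB2 : MemLp α 2 (fwdPathLaw ν₁ κR)) {ΔF : ℝ}
    (hΔF : Real.exp (-ΔF) = ((ν₀ univ)⁻¹ * ν₁ univ).toReal) {a b : ℕ} (ha : 0 < a) (hb : 0 < b)
    (hV : 0 < ((∫ ε, (α ε * Real.exp (-W ε)) ^ 2 ∂(fwdPathLaw ν₀ κF)) /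
          (∫ ε, α ε * Real.exp (-W ε) ∂(fwdPathLaw ν₀ κF)) ^ 2 - 1) / a +
        ((∫ ε, α ε ^ 2 ∂(fwdPathLaw ν₁ κR)) / (∫ ε, α ε ∂(fwdPathLaw ν₁ κR)) ^ 2 - 1) / b)
    {z : ℝ} (hz : 0 ≤ z) :
    haveI := isProbabilityMeasure_fwdPathLaw ν₀ h0 κF
    haveI := isProbabilityMeasure_fwdPathLaw ν₁ h1 κR
    Tendsto (fun n : ℕ => (Measure.infinitePi fun _ : ℕ =>
        (Measure.pi fun _ : Fin a => fwdPathLaw ν₀ κF).prod (Measure.pi fun _ : Fin b => fwdPathLaw ν₁ κR))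
        {ω | |√(n : ℝ) *
            (-Real.log ((∑ k ∈ range n, ∑ l, α ((ω k).1 l) * Real.exp (-W ((ω k).1 l))) / (a * n) /
              ((∑ k ∈ range n, ∑ l, α ((ω k).2 l)) / (b * n))) - ΔF) /
          √((((a : ℝ) * n) * (∑ k ∈ range n, ∑ l, (α ((ω k).1 l) * Real.exp (-W ((ω k).1 l))) ^ 2) /
                (∑ k ∈ range n, ∑ l, α ((ω k).1 l) * Real.exp (-W ((ω k).1 l))) ^ 2 - 1) / a +
            (((b : ℝ) * n) * (∑ k ∈ range n, ∑ l, α ((ω k).2 l) ^ 2) /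
                (∑ k ∈ range n, ∑ l, α ((ω k).2 l)) ^ 2 - 1) / b)| ≤ z})
      atTop (𝓝 (gaussianReal 0 1 (Icc (-z) z))) := by
  haveI := isProbabilityMeasure_fwdPathLaw ν₀ h0 κF
  haveI := isProbabilityMeasure_fwdPathLaw ν₁ h1 κR
  have hlim := h.tendstoInDistribution_twoSample_blocks_studentized h0 h1 hαm hαpos hA2 hB2 hΔF ha hb hV
    (P' := gaussianReal 0 1) (Z := id) HasLaw.id
  have hnull : ((gaussianReal 0 1).map id) (frontier (Icc (-z) z)) = 0 := by
    rw [Measure.map_id, frontier_Icc (by linarith : -z ≤ z)]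
    haveI := nullSingletonClass_gaussianReal (μ := 0) (v := 1) one_ne_zero
    exact (Set.toFinite {-z, z}).measure_zero _
  have key := ProbabilityMeasure.tendsto_measure_of_null_frontier_of_tendsto' hlim.tendsto
    (E := Icc (-z) z) (by simpa using hnull)
  simp only [ProbabilityMeasure.coe_mk, Measure.map_id] at key
  refine key.congr fun n => ?_
  rw [Measure.map_apply_of_aemeasurable (hlim.forall_aemeasurable n) measurableSet_Icc]
  congr 1
  ext ω
  simp only [Set.mem_preimage, Set.mem_Icc, mem_setOf_eq, abs_le]

end CrooksPair

end Summit.Ventures.LatticeQCDFlow.Exactness.GeneralNCMC
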